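import Literature.NumberTheory.LFunctions.DeterminantEquationDFIProofs
import Literature.NumberTheory.LFunctions.DeterminantEquationDFITheorem1
import HarnessLib

/-!
# Discharges of named facts of `DeterminantEquationDFI.lean`

`Literature/NumberTheory/LFunctions/DeterminantEquationDFIHolds.lean` — proofs-only sibling of
`DeterminantEquationDFI.lean` (no definitions, no named facts). Each theorem below closes a
named fact `X : Prop` of that file as `X_holds : X` by composing an ACCEPTED reduction theorem
of the tree with the ACCEPTED unconditional `_holds` discharges of all of its hypotheses;
nothing is re-proved and no statement is changed. Recorded by the librarian sweep g25
(2026-08-16, pass 5c: facts dischargeable in one line from the tree's own lemmas), so that the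
facts census, `#h21_route_deps` and the cone guardrail see these facts as theorems.

Discharged here:

* `DukeFriedlanderIwaniec1997_determinant_holds` :=
  `determinant_of_bilinearKloostermanFractions`
  `DukeFriedlanderIwaniec1997_bilinearKloostermanFractions_holds`
  (`DeterminantEquationDFITheorem1.lean`).

## References

* [DukeFriedlanderIwaniec1997Determinant] — see `lean/references.bib` and the docstring of the fact in `DeterminantEquationDFI.lean`.
-/

namespace Literature.NumberTheory.LFunctions

/-- **Discharge of the named fact `DukeFriedlanderIwaniec1997_determinant`**
(`DeterminantEquationDFI.lean`): Duke–Friedlander–Iwaniec, representations by the determinant,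
Theorem 1 (LMS LNS 237 (1997), p. 110). … — obtained as
`determinant_of_bilinearKloostermanFractions` applied to the tree's unconditional discharge
`DukeFriedlanderIwaniec1997_bilinearKloostermanFractions_holds` of its hypothesis (reduction
in `DeterminantEquationDFITheorem1.lean`).
[cite: DukeFriedlanderIwaniec1997Determinant, Theorem 1, p. 110] -/
theorem DukeFriedlanderIwaniec1997_determinant_holds :
    DukeFriedlanderIwaniec1997_determinant :=
  determinant_of_bilinearKloostermanFractions
    DukeFriedlanderIwaniec1997_bilinearKloostermanFractions_holds

end Literature.NumberTheory.LFunctions
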